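import Summits.BirchSwinnertonDyer.Rank1Residual.X2.TwistMinimal
import Literature.NumberTheory.EllipticCurves.QuadraticTwistKroneckerLFunctionProofs
import Literature.NumberTheory.EllipticCurves.QuadraticTwistMinimalModelProofs
import Literature.NumberTheory.EllipticCurves.NeronComponentIndexTypeI0starProofs
import Literature.NumberTheory.EllipticCurves.TamagawaRingEquivProofs
import Literature.NumberTheory.EllipticCurves.BSDConductorProofs
import Literature.NumberTheory.EllipticCurves.LFunctionPrimeCoeff
import Literature.NumberTheory.EllipticCurves.TamagawaProofs
import Literature.NumberTheory.DiophantineGeometry.TateAlgorithmOrdDiscriminant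
import Literature.NumberTheory.DiophantineGeometry.TateAlgorithmProofs
import Literature.NumberTheory.DiophantineGeometry.MinimalDiscriminantNormProofs
import Literature.NumberTheory.DiophantineGeometry.MinimalDiscriminantSmulProofs
import Literature.NumberTheory.DiophantineGeometry.MinimalDiscriminantProofs
import Literature.NumberTheory.DiophantineGeometry.LocalReductionProofs
import HarnessLib

/-!
# The quadratic twist of a curve of good reduction: Kodaira type `I₀*` at a prime `ℓ ≥ 5` exactly
# dividing the twisting parameter, good reduction at the primes not dividing it; hence
# `p ∤ c_ℓ(E^{(d)})` for every odd `p` (cell `b2b-bsdres`, unit `b2b-bsdres-eisenstein-p2`, gen 3)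

HONEST FRAMING (run/shared/lean/b2b/bsd-rank1-residual/, verbatim in every file): the goal of the
cell is to DELETE the COMBINATION-SHAPED residual classes of the Birch–Swinnerton-Dyer formula for
ALL analytic-rank `≤ 1` elliptic curves over `ℚ` — "full BSD formula for every rank `≤ 1` curve in
class `C`" assembled STRICTLY from published theorems — so that the rank-`≤ 1` remainder becomes
exactly the CONSTRUCTION-SHAPED classes, which are TYPED (missing-input `Prop`s), NOT attempted.
This is not "finishing BSD". Research routes; no claim beyond stated classes. Theorems only (no
definition, no named fact); everything below is ELEMENTARY local arithmetic of Weierstrass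
equations, assembled from tree theorems (Tate's algorithm, Ogg's formula in the tame case,
Kodaira–Néron), towards transport item (d) of sub-cell X2c's class-level chain
(`X2.TwistTransportPackage`, `X2/RankOneHeegnerClass.lean`; companion `X2/TwistTamagawa.lean`).

Let `W/ℚ` be a GLOBALLY MINIMAL Weierstrass equation with good reduction at the place `v` over a
prime `ℓ`, and `D` a non-zero integer; `W^{(D)}` is the tree's twisted equation
`y² = x³ + D(b₂/4)x² + D²(b₄/2)x + D³(b₆/4)` (`WeierstrassCurve.quadraticTwist`), `Wd = Cd • W^{(D)}`
any `ℚ`-isomorphic equation.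

* `ordMinimalDiscriminant_quadraticTwist_of_dvd` — `ℓ` odd, `ℓ ∥ D`: `ord_v Δ_min(W^{(D)}) = 6`
  (the twisted equation is `v`-integral with `v(Δ) = v(D⁶Δ_W) = 6 < 12`, hence minimal at `v`;
  Silverman *AEC* VII.1 Rem. 1.1 — the computation inside the tree's
  `hasAdditiveReductionAt_quadraticTwist_of_dvd`, exported).
* `kodairaSymbolAt_twist_of_dvd` — **`ℓ ≥ 5`, `ℓ ∥ D`: `Wd` has Kodaira type `I₀*` at `v`.**
  Additive reduction (tree) with `ord_v Δ_min = 6`; Ogg's formula in the tame case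
  (`ordMinimalDiscriminant_eq_numComponentsAt_add_one_holds`, residue characteristic `≠ 2, 3`)
  gives `m_v = 5`, and the only Kodaira symbols with five components are `I₅` (multiplicative —
  excluded) and `I₀*` (Silverman *ATAEC* IV.9.4, Table 4.1).
* `padicValNat_localTamagawaNumber_twist_of_dvd` — hence `c_ℓ(Wd) ∈ {1, 2, 4}` (Tate's algorithm
  Step 6, `localTamagawaNumber_of_kodairaSymbolAt_eq_Istar_zero_holds`) and `ord_p c_ℓ(Wd) = 0` for
  every ODD prime `p` — the case `p = 3` being the point (for `p ≥ 5` the bound `c ≤ 4` suffices,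
  `X11b.padicValNat_localTamagawaNumber_twist_eq`, multr1-p2).
* `hasGoodReductionAt_twist_of_not_dvd` — `D ≡ 1 (mod 4)`, `ℓ ∤ D` (ANY `ℓ`, `ℓ = 2` included):
  `Wd` has good reduction at `v` (the twist is unramified at `v`: `W^{(D)} ≅ W.twistModel k`,
  `D = 4k + 1`, and `ord_v Δ_min` is unchanged, `ordMinimalDiscriminant_twistModel`); so
  `c_ℓ(Wd) = 1` (`localTamagawaNumber_twist_of_not_dvd`).

References: [SilvermanAEC2009] VII.1 Rem. 1.1, Prop. 1.3, VII.5 Prop. 5.1, VII.6 Thm. 6.1;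
[SilvermanATAEC1994] IV.9.4 (Steps 2, 6; Table 4.1), IV.10.4, IV.11.1; S. Comalada, J. Number
Theory 49 (1994) §2; [JetchevSkinnerWan2017] §7.4.1 (eq:tamK) ("`p ∤ c_ℓ(E^K) ≤ 4` at the primes
`ℓ ∣ d_K` of additive reduction").
-/

set_option autoImplicit false

noncomputable section

open scoped Classical

open IsDedekindDomain IsDedekindDomain.HeightOneSpectrum NumberField Rat.HeightOneSpectrum
  WeierstrassCurve Literature.NumberTheory.EllipticCurves
  Literature.NumberTheory.DiophantineGeometry

namespace Summit.BirchSwinnertonDyer.Rank1Residual.X2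

/-! ### The residue characteristic of a place of `ℚ` -/

/-- The residue ring of `𝓞 ℚ` at the place `v` over the prime `ℓ` has characteristic `ℓ`.
[folklore] -/
theorem ringChar_quot_asIdeal_eq_primesEquiv (v : HeightOneSpectrum (𝓞 ℚ)) :
    ringChar (𝓞 ℚ ⧸ v.asIdeal) = (primesEquiv v : ℕ) := by
  have hp : (primesEquiv v : ℕ).Prime := (primesEquiv v).2
  have hmem : ((primesEquiv v : ℕ) : 𝓞 ℚ) ∈ v.asIdeal :=
    (natCast_mem_asIdeal_iff_eq_primesEquiv_symm v hp).mpr (by simp)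
  haveI : Nontrivial (𝓞 ℚ ⧸ v.asIdeal) := Ideal.Quotient.nontrivial_iff.mpr v.isPrime.ne_top
  apply CharP.ringChar_of_prime_eq_zero hp
  rw [← map_natCast (Ideal.Quotient.mk v.asIdeal), Ideal.Quotient.eq_zero_iff_mem]
  exact hmem

/-! ### `ℓ ∥ D`, `ℓ` odd: `ord_v Δ_min(W^{(D)}) = 6` -/

/-- **`ord_v Δ_min(W^{(D)}) = 6`** for the twist of a globally minimal `W/ℚ` with good reduction at
the place `v` over an odd prime `ℓ` exactly dividing `D`: the twisted equation
`y² = x³ + D(b₂/4)x² + D²(b₄/2)x + D³(b₆/4)` is `v`-integral with `v(Δ) = v(D⁶ Δ_W) = 6 < 12`, hence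
minimal at `v` (Silverman, *AEC* VII.1 Rem. 1.1), and the minimal discriminant is read off a
minimal equation (VII.1 Prop. 1.3, `valuation_Δ_eq_of_isMinimalAt_holds`). The valuations are
computed exactly as in the tree's `hasAdditiveReductionAt_quadraticTwist_of_dvd`.
[cite: SilvermanAEC2009, VII.1 Remark 1.1 and Prop. 1.3] -/
theorem ordMinimalDiscriminant_quadraticTwist_of_dvd (W : WeierstrassCurve ℚ) [W.IsElliptic]
    [W.IsGloballyMinimal] (v : HeightOneSpectrum (𝓞 ℚ)) (hv2 : (primesEquiv v : ℕ) ≠ 2) {D : ℤ}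
    (hD0 : D ≠ 0) (h1 : ((primesEquiv v : ℕ) : ℤ) ∣ D) (h2 : ¬ ((primesEquiv v : ℕ) : ℤ) ^ 2 ∣ D)
    (hgood : W.HasGoodReductionAt v) :
    (W.quadraticTwist (D : ℚ)).ordMinimalDiscriminant v = 6 := by
  have hpP : (primesEquiv v : ℕ).Prime := (primesEquiv v).2
  have hpZ : Prime ((primesEquiv v : ℕ) : ℤ) := Nat.prime_iff_prime_int.mp hpP
  have hp2 : ¬ ((primesEquiv v : ℕ) : ℤ) ∣ 2 := fun h ↦
    hv2 ((Nat.prime_dvd_prime_iff_eq hpP Nat.prime_two).mp (Int.natCast_dvd_natCast.mp h))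
  have hp4 : ¬ ((primesEquiv v : ℕ) : ℤ) ∣ 4 := fun h ↦
    (hpZ.dvd_or_dvd (show ((primesEquiv v : ℕ) : ℤ) ∣ 2 * 2 by norm_num; exact h)).elim hp2 hp2
  have hDq : (D : ℚ) ≠ 0 := by exact_mod_cast hD0
  haveI := W.isElliptic_quadraticTwist hDq
  set M : WeierstrassCurve ℤ := integralModelInt W with hM
  have hWM : M.map (Int.castRingHom ℚ) = W := map_integralModelInt W
  have hWb₂ : W.b₂ = (M.b₂ : ℚ) := by rw [← congrArg WeierstrassCurve.b₂ hWM, map_b₂, eq_intCast]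
  have hWb₄ : W.b₄ = (M.b₄ : ℚ) := by rw [← congrArg WeierstrassCurve.b₄ hWM, map_b₄, eq_intCast]
  have hWb₆ : W.b₆ = (M.b₆ : ℚ) := by rw [← congrArg WeierstrassCurve.b₆ hWM, map_b₆, eq_intCast]
  have hv4 : v.valuation ℚ (4 : ℚ) = 1 := by
    have h := valuation_ringOfIntegers_intCast_eq_one v (n := 4) (by exact_mod_cast hp4)
    simpa using h
  have hv2' : v.valuation ℚ (2 : ℚ) = 1 := by
    have h := valuation_ringOfIntegers_intCast_eq_one v (n := 2) (by exact_mod_cast hp2)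
    simpa using h
  have hvD : v.valuation ℚ (D : ℚ) = WithZero.exp (-1 : ℤ) :=
    valuation_ringOfIntegers_intCast_eq_exp_neg_one v h1 h2
  have hvΔ : v.valuation ℚ W.Δ = 1 :=
    (hasGoodReductionAt_iff_of_isMinimalAt (v := v) (W := W) (IsGloballyMinimal.isMinimal v)).mp hgood
  have hvb₂ : v.valuation ℚ W.b₂ ≤ 1 := hWb₂ ▸ valuation_ringOfIntegers_intCast_le_one v _
  have hvb₄ : v.valuation ℚ W.b₄ ≤ 1 := hWb₄ ▸ valuation_ringOfIntegers_intCast_le_one v _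
  have hvb₆ : v.valuation ℚ W.b₆ ≤ 1 := hWb₆ ▸ valuation_ringOfIntegers_intCast_le_one v _
  have he1 : WithZero.exp (-1 : ℤ) ≤ 1 := by
    rw [← WithZero.exp_zero]; exact WithZero.exp_le_exp.mpr (by norm_num)
  -- the twisted equation is `v`-integral
  have hint : (W.quadraticTwist (D : ℚ)).IsIntegralAt v := by
    refine (W.quadraticTwist (D : ℚ)).isIntegralAt_of_valuation_le_one v ?_ ?_ ?_ ?_ ?_
    · simp
    · simp only [quadraticTwist_a₂, map_div₀, map_mul, hv4, hvD, div_one]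
      exact mul_le_one' he1 hvb₂
    · simp
    · simp only [quadraticTwist_a₄, map_div₀, map_mul, map_pow, hv2', hvD, div_one]
      exact mul_le_one' (pow_le_one' he1 2) hvb₄
    · simp only [quadraticTwist_a₆, map_div₀, map_mul, map_pow, hv4, hvD, div_one]
      exact mul_le_one' (pow_le_one' he1 3) hvb₆
  -- `v(Δ) = 6`, so the equation is minimal at `v`
  have hΔ : v.valuation ℚ (W.quadraticTwist (D : ℚ)).Δ = WithZero.exp (-6 : ℤ) := by
    rw [quadraticTwist_Δ, map_mul, map_pow, hvD, hvΔ, mul_one, ← WithZero.exp_nsmul]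
    norm_num
  have hmin : (W.quadraticTwist (D : ℚ)).IsMinimalAt v :=
    isMinimalAt_of_lt_valuation_Δ_holds hint (by rw [hΔ]; exact WithZero.exp_lt_exp.mpr (by norm_num))
  -- read off the minimal discriminant
  have hread := valuation_Δ_eq_of_isMinimalAt_holds (v := v) (W := W.quadraticTwist (D : ℚ)) hmin
  rw [hΔ] at hread
  have h6 := WithZero.exp_injective hread
  omega

/-! ### `ℓ ∥ D`, `ℓ ≥ 5`: Kodaira type `I₀*` -/

/-- **The twist of a curve of good reduction by a parameter exactly divisible by `ℓ ≥ 5` has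
Kodaira type `I₀*` at `ℓ`.** For `W/ℚ` globally minimal with good reduction at the place `v` over
a prime `ℓ ≥ 5`, an integer `D` with `ℓ ∥ D`, and any equation `Wd = Cd • W^{(D)}`:
`Wd.kodairaSymbolAt v = I₀*`. Proof: the reduction is additive
(`hasAdditiveReductionAt_quadraticTwist_of_dvd`, invariant under `Cd`) with `ord_v Δ_min = 6`
(`ordMinimalDiscriminant_quadraticTwist_of_dvd`, invariant under `Cd`); in residue characteristic
`≥ 5` Ogg's formula is tame, `ord_v Δ_min = m_v + 1`
(`ordMinimalDiscriminant_eq_numComponentsAt_add_one_holds`), so `m_v = 5`; by Table 4.1 the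
Kodaira symbols with five components are `I₅` — multiplicative (`kodairaSymbolAt_eq_I_iff_holds`),
impossible here — and `I₀*`. [cite: SilvermanATAEC1994, IV.9.4 with Table 4.1 (p. 365) and IV.11.1]
[cite: SilvermanAEC2009, VII.5 Prop. 5.1(c)] -/
theorem kodairaSymbolAt_twist_of_dvd (W : WeierstrassCurve ℚ) [W.IsElliptic]
    [W.IsGloballyMinimal] (v : HeightOneSpectrum (𝓞 ℚ)) (hv5 : 5 ≤ (primesEquiv v : ℕ)) {D : ℤ}
    (hD0 : D ≠ 0) (h1 : ((primesEquiv v : ℕ) : ℤ) ∣ D) (h2 : ¬ ((primesEquiv v : ℕ) : ℤ) ^ 2 ∣ D)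
    (hgood : W.HasGoodReductionAt v) {Wd : WeierstrassCurve ℚ} [Wd.IsElliptic]
    (Cd : VariableChange ℚ) (hWd : Cd • W.quadraticTwist (D : ℚ) = Wd) :
    Wd.kodairaSymbolAt v = .Istar 0 := by
  have hv2 : (primesEquiv v : ℕ) ≠ 2 := by omega
  have hDq : (D : ℚ) ≠ 0 := by exact_mod_cast hD0
  haveI := W.isElliptic_quadraticTwist hDq
  -- additive reduction with `ord_v Δ_min = 6`, both transported along `Cd`
  have haddX : (W.quadraticTwist (D : ℚ)).HasAdditiveReductionAt v :=
    W.hasAdditiveReductionAt_quadraticTwist_of_dvd v hv2 hD0 h1 h2 hgood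
  have hadd : Wd.HasAdditiveReductionAt v := by
    rw [← hWd]
    exact (hasAdditiveReductionAt_smul_iff_holds v (W.quadraticTwist (D : ℚ)) Cd).mpr haddX
  have hord : Wd.ordMinimalDiscriminant v = 6 := by
    rw [← hWd, ordMinimalDiscriminant_smul_holds v (W.quadraticTwist (D : ℚ)) Cd]
    exact ordMinimalDiscriminant_quadraticTwist_of_dvd W v hv2 hD0 h1 h2 hgood
  -- Ogg's formula, tame case: `ord_v Δ_min = m_v + 1`
  have hchar := ringChar_quot_asIdeal_eq_primesEquiv v
  have hc2 : ringChar (𝓞 ℚ ⧸ v.asIdeal) ≠ 2 := by rw [hchar]; omega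
  have hc3 : ringChar (𝓞 ℚ ⧸ v.asIdeal) ≠ 3 := by rw [hchar]; omega
  have hOgg := ordMinimalDiscriminant_eq_numComponentsAt_add_one_holds v Wd hadd hc2 hc3
  rw [hord] at hOgg
  have hm : (Wd.kodairaSymbolAt v).numComponents = 5 := by
    change 6 = (Wd.kodairaSymbolAt v).numComponents + 1 at hOgg
    omega
  -- five components: `I₅` (multiplicative, excluded) or `I₀*`
  rcases hk : Wd.kodairaSymbolAt v with (_ | n) | _ | _ | _ | n | _ | _ | _ <;>
    rw [hk] at hm <;> simp only [KodairaSymbol.numComponents] at hm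
  all_goals try omega
  · -- `Iₙ₊₁` with `n + 1 = 5`: multiplicative reduction, contradicting additive reduction
    obtain ⟨hmult, -⟩ := (kodairaSymbolAt_eq_I_iff_holds v Wd n.succ_ne_zero).mp hk
    exact absurd hadd hmult.not_hasAdditiveReductionAt
  · -- `Iₙ*` with `n + 5 = 5`
    have hn : n = 0 := by omega
    rw [hn]

/-- **`c_ℓ(Wd) ∈ {1, 2, 4}` and `ord_p c_ℓ(Wd) = 0` for every odd prime `p`**, for the twist
`Wd = Cd • W^{(D)}` of a globally minimal `W/ℚ` with good reduction at the place `v` over `ℓ ≥ 5`,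
`ℓ ∥ D` (type `I₀*`: Tate's algorithm Step 6, `localTamagawaNumber_of_kodairaSymbolAt_eq_Istar_zero_holds`;
the `ℚ_v`/`ℚ_[ℓ]` comparison is `localTamagawaNumber_padic_eq_holds`). For `p ≥ 5` this is also the
bound `c ≤ 4` (multr1-p2's `X11b.padicValNat_localTamagawaNumber_twist_eq`); the content is `p = 3`.
[cite: SilvermanATAEC1994, IV.9.4 Step 6 (PDF p. 345)] [cite: JetchevSkinnerWan2017, §7.4.1 (eq:tamK)] -/
theorem padicValNat_localTamagawaNumber_twist_of_dvd (W : WeierstrassCurve ℚ) [W.IsElliptic]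
    [W.IsGloballyMinimal] (p : ℕ) [Fact p.Prime] (hp2 : p ≠ 2) (ℓ : ℕ) [Fact ℓ.Prime] (hℓ5 : 5 ≤ ℓ)
    {D : ℤ} (hD0 : D ≠ 0) (h1 : (ℓ : ℤ) ∣ D) (h2 : ¬ (ℓ : ℤ) ^ 2 ∣ D)
    (hgood : W.HasGoodReductionAtPrime ℓ) {Wd : WeierstrassCurve ℚ} [Wd.IsElliptic]
    (Cd : VariableChange ℚ) (hWd : Cd • W.quadraticTwist (D : ℚ) = Wd) :
    padicValNat p ((Wd.baseChange ℚ_[ℓ]).localTamagawaNumber ℤ_[ℓ]) = 0 := by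
  have hpP : p.Prime := Fact.out
  have hℓP : ℓ.Prime := Fact.out
  -- the place of `𝓞 ℚ` over `ℓ`
  obtain ⟨v, hv⟩ : ∃ v : HeightOneSpectrum (𝓞 ℚ), ((primesEquiv v : ℕ)) = ℓ :=
    ⟨primesEquiv.symm ⟨ℓ, hℓP⟩, by rw [Equiv.apply_symm_apply]⟩
  have hgood' : W.HasGoodReductionAt v := by
    rw [← hasGoodReductionAtPrime_iff_hasGoodReductionAt_ringOfIntegers v W]
    convert hgood
  haveI : Finite (IsLocalRing.ResidueField (v.adicCompletionIntegers ℚ)) :=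
    HeightOneSpectrum.finite_residueField_adicCompletionIntegers ℚ v
  haveI : PerfectField (IsLocalRing.ResidueField (v.adicCompletionIntegers ℚ)) :=
    PerfectField.ofFinite
  have hk := kodairaSymbolAt_twist_of_dvd W v (by rw [hv]; exact hℓ5) hD0 (by rw [hv]; exact h1)
    (by rw [hv]; exact h2) hgood' Cd hWd
  have hc := localTamagawaNumber_of_kodairaSymbolAt_eq_Istar_zero_holds v Wd hk
  rw [localTamagawaNumber_padic_eq_holds Wd v ℓ hv]
  have hp2' : ¬ p ∣ 2 := fun h => hp2 ((Nat.prime_dvd_prime_iff_eq hpP Nat.prime_two).mp h)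
  have hp4 : ¬ p ∣ 4 := fun h =>
    hp2' ((Nat.Prime.dvd_mul hpP).mp (show p ∣ 2 * 2 by norm_num; exact h) |>.elim id id)
  rcases hc with h | h | h <;> rw [h]
  · simp
  · exact padicValNat.eq_zero_of_not_dvd hp2'
  · exact padicValNat.eq_zero_of_not_dvd hp4

/-! ### `ℓ ∤ D`, `D ≡ 1 (mod 4)`: good reduction is preserved (twist unramified at `v`) -/

/-- **Good reduction is preserved by a quadratic twist unramified at `v`** — for EVERY residue
characteristic, `ℓ = 2` included: for `W/ℚ` elliptic with good reduction at the place `v` over `ℓ`,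
an integer `D = 4k + 1` with `ℓ ∤ D`, and any equation `Wd = Cd • W^{(D)}`, `Wd` has good reduction
at `v`. The twisted equation is `ℚ`-isomorphic to the integral twist model `W.twistModel k`
(`exists_variableChange_twistModel_eq_quadraticTwist`, completing the square), whose minimal
discriminant at `v` equals that of `W` because `k` is `v`-integral and `4k + 1` is a `v`-unit
(`ordMinimalDiscriminant_twistModel`; Silverman *AEC* VII.1 Prop. 1.3, Comalada 1994 §2); and
`ord_v Δ_min = 0` iff good reduction (VII.5 Prop. 5.1(a), `ordMinimalDiscriminant_eq_zero_iff_holds`).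
[cite: SilvermanAEC2009, VII.1 Prop. 1.3 and VII.5 Prop. 5.1(a)] -/
theorem hasGoodReductionAt_twist_of_not_dvd (W : WeierstrassCurve ℚ) [W.IsElliptic]
    (v : HeightOneSpectrum (𝓞 ℚ)) {D k : ℤ} (hDk : D = 4 * k + 1)
    (hvD : ¬ ((primesEquiv v : ℕ) : ℤ) ∣ D) (hgood : W.HasGoodReductionAt v)
    {Wd : WeierstrassCurve ℚ} [Wd.IsElliptic] (Cd : VariableChange ℚ)
    (hWd : Cd • W.quadraticTwist (D : ℚ) = Wd) : Wd.HasGoodReductionAt v := by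
  -- the twist model and its parameters at `v`
  have hk : v.valuation ℚ (k : ℚ) ≤ 1 := valuation_ringOfIntegers_intCast_le_one v k
  have hd : v.valuation ℚ (4 * (k : ℚ) + 1) = 1 := by
    have h := valuation_ringOfIntegers_intCast_eq_one v hvD
    rw [hDk] at h
    push_cast at h
    exact h
  have hordT : (W.twistModel (k : ℚ)).ordMinimalDiscriminant v = 0 := by
    rw [ordMinimalDiscriminant_twistModel v W hk hd]
    exact (ordMinimalDiscriminant_eq_zero_iff_holds v W).mpr hgood
  -- `W^{(D)} = C • W.twistModel k`
  obtain ⟨C, -, hC⟩ := exists_variableChange_twistModel_eq_quadraticTwist W (k : ℚ)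
  have hDq : (4 * (k : ℚ) + 1) = (D : ℚ) := by rw [hDk]; push_cast; ring
  rw [hDq] at hC
  have hD0 : (D : ℚ) ≠ 0 := by
    intro h0
    rw [← hDq] at h0
    rw [h0, map_zero] at hd
    exact zero_ne_one hd
  haveI : (W.quadraticTwist (D : ℚ)).IsElliptic := W.isElliptic_quadraticTwist hD0
  haveI : (W.twistModel (k : ℚ)).IsElliptic := by
    have h : C⁻¹ • W.quadraticTwist (D : ℚ) = W.twistModel (k : ℚ) := by
      rw [← hC, smul_smul, inv_mul_cancel, one_smul]
    rw [← h]; infer_instance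
  have hgoodT : (W.twistModel (k : ℚ)).HasGoodReductionAt v :=
    (ordMinimalDiscriminant_eq_zero_iff_holds v (W.twistModel (k : ℚ))).mp hordT
  have hgoodX : (W.quadraticTwist (D : ℚ)).HasGoodReductionAt v := by
    rw [← hC]
    exact (hasGoodReductionAt_smul_iff_holds v (W.twistModel (k : ℚ)) C).mpr hgoodT
  rw [← hWd]
  exact (hasGoodReductionAt_smul_iff_holds v (W.quadraticTwist (D : ℚ)) Cd).mpr hgoodX

/-- **`c_ℓ(Wd) = 1` at a prime `ℓ ∤ D` of good reduction of `W`** (`D ≡ 1 (mod 4)`; ANY `ℓ`):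
`Wd = Cd • W^{(D)}` has good reduction at `ℓ` (`hasGoodReductionAt_twist_of_not_dvd`), and
`c = 1` at a prime of good reduction (Silverman *AEC* VII.2, remark after Prop. 2.1; Tate's
algorithm Step 1). [cite: SilvermanAEC2009, VII.5 Prop. 5.1(a) and §VII.2 (remark after Prop. 2.1)] -/
theorem localTamagawaNumber_twist_of_not_dvd (W : WeierstrassCurve ℚ) [W.IsElliptic]
    (ℓ : ℕ) [Fact ℓ.Prime] {D k : ℤ} (hDk : D = 4 * k + 1) (hℓD : ¬ (ℓ : ℤ) ∣ D)
    (hgood : W.HasGoodReductionAtPrime ℓ) {Wd : WeierstrassCurve ℚ} [Wd.IsElliptic]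
    (Cd : VariableChange ℚ) (hWd : Cd • W.quadraticTwist (D : ℚ) = Wd) :
    (Wd.baseChange ℚ_[ℓ]).localTamagawaNumber ℤ_[ℓ] = 1 := by
  have hℓP : ℓ.Prime := Fact.out
  obtain ⟨v, hv⟩ : ∃ v : HeightOneSpectrum (𝓞 ℚ), ((primesEquiv v : ℕ)) = ℓ :=
    ⟨primesEquiv.symm ⟨ℓ, hℓP⟩, by rw [Equiv.apply_symm_apply]⟩
  have hgood' : W.HasGoodReductionAt v := by
    rw [← hasGoodReductionAtPrime_iff_hasGoodReductionAt_ringOfIntegers v W]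
    convert hgood
  have hgoodd : Wd.HasGoodReductionAt v :=
    hasGoodReductionAt_twist_of_not_dvd W v hDk (by rw [hv]; exact hℓD) hgood' Cd hWd
  have hgooddP : Wd.HasGoodReductionAtPrime ℓ := by
    have h := (hasGoodReductionAtPrime_iff_hasGoodReductionAt_ringOfIntegers v Wd).mpr hgoodd
    convert h; exact hv.symm
  haveI : (Wd.baseChange ℚ_[ℓ]).IsElliptic := inferInstanceAs (Wd.map (algebraMap ℚ ℚ_[ℓ])).IsElliptic
  haveI : ((Wd.baseChange ℚ_[ℓ]).minimal ℤ_[ℓ]).HasGoodReduction ℤ_[ℓ] := hgooddP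
  exact localTamagawaNumber_eq_one_of_hasGoodReduction_holds ℤ_[ℓ] _

end Summit.BirchSwinnertonDyer.Rank1Residual.X2

end
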